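import Summits.HodgeConjecture.HodgeConjecture.Theorems.PadicSemiregularLiftFermatAnchorAssemblyEulerHomDim

/-!
# The `ℤ`-graded Hom complex of a pair of graded matrix factorizations, VII: ranks under base change (line `witt-lift-rigid-mf`)

Crux `FermatAnchorAssembly` (stmt-HodgeConjecture-14874), stub `stub_eulerBaseChange`; continues
`…EulerCoords.lean`, `…EulerHomDim.lean`.

For data `M, N` over a commutative ring `A` and a ring map `σ : A → F` to a field, the ranks
`dRank t`, `hRank t` of the differentials of the base-changed pair `(M ⊗_σ F, N ⊗_σ F)` are the
dimensions of the `F`-spans of the `σ`-images of ONE finite family of vectors over `A` — the images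
under `dMap M N` / `hMap M N` of the monomial basis of the cochain lattice over `A`:

* `pairMap σ` — entrywise change of coefficients on pairs of polynomial matrices (additive,
  `σ`-semilinear, injective for injective `σ`, commuting with `dMap`, `hMap`, `entryAt`, `coordMap`);
* `homogBasis L Λ : admSet L Λ → pairs over A` — the monomial basis of `homogSub L Λ` (via `coordEquiv`),
  and `homogSub_baseChange_eq_span`: over `F`, `homogSub L Λ = span_F (σ-images of the A-basis)`;
* `dRank_baseChange`, `hRank_baseChange` (registered as `hRank_baseChange_eq_finrank_span`):
  `dRank t (M ⊗ F) (N ⊗ F) = dim_F span_F {pairMap σ (dMap M N (e_q))}_q`, and likewise for `hRank`.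

This is the field-independent half of the rank comparison between the two fibres of `𝕎 𝕜`; the
Witt-vector half (ranks over the residue field are at most ranks over the fraction field) is the next
file. All `[folklore]`; no named fact, no `sorry`.
-/

-- `Summit.HodgeConjecture.HodgeConjecture.…` is the tree's mandated summit/problem namespace (single-problem summit).
set_option linter.dupNamespace false

noncomputable section

open Finset Module
open scoped Classical

namespace Summit.HodgeConjecture.HodgeConjecture.Cruxes.FermatAnchorAssembly.WittLiftRigidMf

variable {ν m : ℕ} {A B : Type} [CommRing A] [CommRing B] {α β γ δ : Type}

/-! ### Change of coefficients on pairs of polynomial matrices -/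

/-- Entrywise change of coefficients `σ` on a pair of polynomial matrices. [folklore] -/
def pairMap (σ : A →+* B) :
    Matrix α β (MvPolynomial (Fin ν) A) × Matrix γ δ (MvPolynomial (Fin ν) A) →+
      Matrix α β (MvPolynomial (Fin ν) B) × Matrix γ δ (MvPolynomial (Fin ν) B) where
  toFun z := (z.1.map (MvPolynomial.map σ), z.2.map (MvPolynomial.map σ))
  map_zero' := by ext <;> simp
  map_add' z z' := by ext <;> simp

/-- Formula for `pairMap`. [folklore] -/
@[simp] theorem pairMap_apply (σ : A →+* B)
    (z : Matrix α β (MvPolynomial (Fin ν) A) × Matrix γ δ (MvPolynomial (Fin ν) A)) :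
    pairMap σ z = (z.1.map (MvPolynomial.map σ), z.2.map (MvPolynomial.map σ)) := rfl

/-- `pairMap` is `σ`-semilinear for the coefficient actions. [folklore] -/
theorem pairMap_smul (σ : A →+* B) (a : A)
    (z : Matrix α β (MvPolynomial (Fin ν) A) × Matrix γ δ (MvPolynomial (Fin ν) A)) :
    pairMap σ (a • z) = σ a • pairMap σ z := by
  ext <;> simp [Matrix.map_apply, MvPolynomial.smul_eq_C_mul, MvPolynomial.map_C]

/-- Entries of `pairMap σ z` are the `σ`-images of the entries of `z`. [folklore] -/
theorem entryAt_pairMap (σ : A →+* B) (pos : (α × β) ⊕ (γ × δ))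
    (z : Matrix α β (MvPolynomial (Fin ν) A) × Matrix γ δ (MvPolynomial (Fin ν) A)) :
    entryAt pos (pairMap σ z) = MvPolynomial.map σ (entryAt pos z) := by
  cases pos <;> rfl

/-- `pairMap σ` is injective for injective `σ`. [folklore] -/
theorem pairMap_injective {σ : A →+* B} (hσ : Function.Injective σ) :
    Function.Injective (pairMap (ν := ν) (α := α) (β := β) (γ := γ) (δ := δ) σ) := by
  intro z z' h
  apply ext_entryAt
  intro pos
  have := congrArg (entryAt pos) h
  rw [entryAt_pairMap, entryAt_pairMap] at this
  exact MvPolynomial.map_injective σ hσ this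

/-- `pairMap` preserves bihomogeneity labels. [folklore] -/
theorem pairMap_mem_homogSub (σ : A →+* B) {L : AddSubgroup (Fin ν → ZMod m)}
    {Λ : (α × β) ⊕ (γ × δ) → ℤ × (Fin ν → ZMod m)}
    {z : Matrix α β (MvPolynomial (Fin ν) A) × Matrix γ δ (MvPolynomial (Fin ν) A)}
    (hz : z ∈ homogSub L Λ) : pairMap σ z ∈ homogSub L Λ := by
  intro pos
  rw [entryAt_pairMap]
  exact (hz pos).map σ

/-- Coordinates commute with `pairMap`: `coord_q (σ_* z) = σ (coord_q z)`. [folklore] -/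
theorem coordMap_pairMap (σ : A →+* B) (L : AddSubgroup (Fin ν → ZMod m))
    (Λ : (α × β) ⊕ (γ × δ) → ℤ × (Fin ν → ZMod m)) (z : homogSub (A := A) L Λ) (q : admSet L Λ) :
    coordMap L Λ ⟨pairMap σ z.1, pairMap_mem_homogSub σ z.2⟩ q = σ (coordMap L Λ z q) := by
  rw [coordMap_apply, coordMap_apply]
  change (entryAt q.1.1 (pairMap σ z.1)).coeff q.1.2 = σ ((entryAt q.1.1 z.1).coeff q.1.2)
  rw [entryAt_pairMap, MvPolynomial.coeff_map]

/-! ### The monomial basis of `homogSub` and its behaviour under base change -/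

section Basis

variable [Finite α] [Finite β] [Finite γ] [Finite δ]

/-- The admissible set as a finite type. [folklore] -/
instance admSet_finite' (L : AddSubgroup (Fin ν → ZMod m)) (Λ : (α × β) ⊕ (γ × δ) → ℤ × (Fin ν → ZMod m)) :
    Finite (admSet L Λ) :=
  (admSet_finite L Λ).to_subtype

/-- The admissible set as a `Fintype` (noncomputably). [folklore] -/
instance admSet_fintype (L : AddSubgroup (Fin ν → ZMod m)) (Λ : (α × β) ⊕ (γ × δ) → ℤ × (Fin ν → ZMod m)) :
    Fintype (admSet L Λ) :=
  Fintype.ofFinite _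

/-- **The monomial basis of `homogSub L Λ` over `A`**: `e_q` has coordinate vector `δ_q`. [folklore] -/
def homogBasis (A : Type) [CommRing A] (L : AddSubgroup (Fin ν → ZMod m))
    (Λ : (α × β) ⊕ (γ × δ) → ℤ × (Fin ν → ZMod m)) (q : admSet L Λ) :
    Matrix α β (MvPolynomial (Fin ν) A) × Matrix γ δ (MvPolynomial (Fin ν) A) :=
  ((coordEquiv (A := A) L Λ).symm (Pi.single q 1) : homogSub (A := A) L Λ)

/-- `e_q ∈ homogSub`. [folklore] -/
theorem homogBasis_mem (L : AddSubgroup (Fin ν → ZMod m)) (Λ : (α × β) ⊕ (γ × δ) → ℤ × (Fin ν → ZMod m))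
    (q : admSet L Λ) : homogBasis A L Λ q ∈ homogSub (A := A) L Λ :=
  ((coordEquiv (A := A) L Λ).symm (Pi.single q 1)).2

/-- The `σ`-image of the `A`-basis vector `e_q` is the `F`-basis vector `e_q`. [folklore] -/
theorem pairMap_homogBasis (σ : A →+* B) (L : AddSubgroup (Fin ν → ZMod m))
    (Λ : (α × β) ⊕ (γ × δ) → ℤ × (Fin ν → ZMod m)) (q : admSet L Λ) :
    pairMap σ (homogBasis A L Λ q) = homogBasis B L Λ q := by
  -- compare coordinates
  have key : (⟨pairMap σ (homogBasis A L Λ q), pairMap_mem_homogSub σ (homogBasis_mem L Λ q)⟩ :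
      homogSub (A := B) L Λ) = (coordEquiv (A := B) L Λ).symm (Pi.single q 1) := by
    apply (coordEquiv (A := B) L Λ).injective
    rw [LinearEquiv.apply_symm_apply]
    funext q'
    have h2 := coordMap_pairMap σ L Λ ((coordEquiv (A := A) L Λ).symm (Pi.single q 1)) q'
    have h3 : coordMap L Λ ((coordEquiv (A := A) L Λ).symm (Pi.single q 1)) q' =
        (Pi.single q (1 : A) : admSet L Λ → A) q' := by
      change (coordEquiv (A := A) L Λ) ((coordEquiv (A := A) L Λ).symm (Pi.single q 1)) q' = _
      rw [LinearEquiv.apply_symm_apply]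
    rw [h3] at h2
    have h4 : σ ((Pi.single q (1 : A) : admSet L Λ → A) q') = (Pi.single q (1 : B) : admSet L Λ → B) q' := by
      by_cases h : q' = q
      · subst h; simp
      · simp [h]
    exact h2.trans h4
  exact congrArg Subtype.val key

/-- **Over any coefficient ring, `homogSub L Λ` is the span of the monomial basis `e_q`.** [folklore] -/
theorem homogSub_eq_span_homogBasis (L : AddSubgroup (Fin ν → ZMod m))
    (Λ : (α × β) ⊕ (γ × δ) → ℤ × (Fin ν → ZMod m)) :
    homogSub (A := A) L Λ = Submodule.span A (Set.range (homogBasis A L Λ)) := by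
  apply le_antisymm
  · intro z hz
    have hdecomp : (⟨z, hz⟩ : homogSub (A := A) L Λ) =
        ∑ q, coordEquiv (A := A) L Λ ⟨z, hz⟩ q • (coordEquiv (A := A) L Λ).symm (Pi.single q 1) := by
      apply (coordEquiv (A := A) L Λ).injective
      rw [map_sum]
      simp only [map_smul, LinearEquiv.apply_symm_apply]
      funext q'
      simp [Finset.sum_apply, Pi.single_apply]
    have hz' : z = ∑ q, coordEquiv (A := A) L Λ ⟨z, hz⟩ q • homogBasis A L Λ q := by
      have := congrArg Subtype.val hdecomp
      simpa [homogBasis] using this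
    rw [hz']
    exact Submodule.sum_mem _ fun q _ ↦ Submodule.smul_mem _ _ (Submodule.subset_span ⟨q, rfl⟩)
  · rw [Submodule.span_le]
    rintro _ ⟨q, rfl⟩
    exact homogBasis_mem L Λ q

/-- **Base change of the cochain lattice**: over `F`, `homogSub L Λ` is the `F`-span of the `σ`-images of
the `A`-basis. [folklore] -/
theorem homogSub_baseChange_eq_span (σ : A →+* B) (L : AddSubgroup (Fin ν → ZMod m))
    (Λ : (α × β) ⊕ (γ × δ) → ℤ × (Fin ν → ZMod m)) :
    homogSub (A := B) L Λ = Submodule.span B (Set.range (fun q ↦ pairMap σ (homogBasis A L Λ q))) := by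
  rw [homogSub_eq_span_homogBasis]
  congr 1
  ext z
  simp only [Set.mem_range, pairMap_homogBasis]

end Basis

/-! ### The differentials commute with change of coefficients -/

namespace GMFData

variable {ι₀ ι₁ κ₀ κ₁ : Type} [Fintype ι₀] [Fintype ι₁] [Fintype κ₀] [Fintype κ₁]

/-- `dMap (M ⊗ B) (N ⊗ B) ∘ σ_* = σ_* ∘ dMap M N`. [folklore] -/
theorem dMap_pairMap (σ : A →+* B) (M : GMFData A ν m ι₀ ι₁) (N : GMFData A ν m κ₀ κ₁)
    (z : Matrix κ₀ ι₀ (MvPolynomial (Fin ν) A) × Matrix κ₁ ι₁ (MvPolynomial (Fin ν) A)) :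
    dMap (M.map σ) (N.map σ) (pairMap σ z) = pairMap σ (dMap M N z) := by
  obtain ⟨a, b⟩ := z
  rw [pairMap_apply, pairMap_apply, dMap_apply, dMap_apply]
  simp only [GMFData.map]
  rw [Matrix.map_sub _ (map_sub _), Matrix.map_sub _ (map_sub _), Matrix.map_mul, Matrix.map_mul,
    Matrix.map_mul, Matrix.map_mul]

/-- `hMap (M ⊗ B) (N ⊗ B) ∘ σ_* = σ_* ∘ hMap M N`. [folklore] -/
theorem hMap_pairMap (σ : A →+* B) (M : GMFData A ν m ι₀ ι₁) (N : GMFData A ν m κ₀ κ₁)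
    (w : Matrix κ₁ ι₀ (MvPolynomial (Fin ν) A) × Matrix κ₀ ι₁ (MvPolynomial (Fin ν) A)) :
    hMap (M.map σ) (N.map σ) (pairMap σ w) = pairMap σ (hMap M N w) := by
  obtain ⟨s, u⟩ := w
  rw [pairMap_apply, pairMap_apply, hMap_apply, hMap_apply]
  simp only [GMFData.map]
  rw [Matrix.map_add _ (map_add _), Matrix.map_add _ (map_add _), Matrix.map_mul, Matrix.map_mul,
    Matrix.map_mul, Matrix.map_mul]

variable {F : Type} [Field F]

/-- **`dRank` of a base change as the dimension of a span of `σ`-images of `A`-vectors.** [folklore] -/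
theorem dRank_baseChange (σ : A →+* F) (L : AddSubgroup (Fin ν → ZMod m)) (t : ℤ)
    (M : GMFData A ν m ι₀ ι₁) (N : GMFData A ν m κ₀ κ₁) :
    dRank L t (M.map σ) (N.map σ) = finrank F (Submodule.span F
      (Set.range (fun q ↦ pairMap σ (dMap M N (homogBasis A L (evenLabel t M N) q))))) := by
  unfold dRank
  rw [cochainSub_eq_homogSub, evenLabel_map, homogSub_baseChange_eq_span σ, Submodule.map_span,
    ← Set.range_comp]
  have hr : (⇑((dMap (M.map σ) (N.map σ)).restrictScalars F) ∘
      fun q ↦ pairMap σ (homogBasis A L (evenLabel t M N) q)) =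
      fun q ↦ pairMap σ (dMap M N (homogBasis A L (evenLabel t M N) q)) := by
    funext q
    simp only [Function.comp_apply, LinearMap.coe_restrictScalars, dMap_pairMap]
  rw [hr]

/-- **`hRank` of a base change as the dimension of a span of `σ`-images of `A`-vectors.** [folklore] -/
theorem hRank_baseChange (σ : A →+* F) (L : AddSubgroup (Fin ν → ZMod m)) (t : ℤ)
    (M : GMFData A ν m ι₀ ι₁) (N : GMFData A ν m κ₀ κ₁) :
    hRank L t (M.map σ) (N.map σ) = finrank F (Submodule.span F
      (Set.range (fun q ↦ pairMap σ (hMap M N (homogBasis A L (oddLabel t M N) q))))) := by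
  unfold hRank nullSub
  rw [oddSub_eq_homogSub, oddLabel_map, homogSub_baseChange_eq_span σ, Submodule.map_span,
    ← Set.range_comp]
  have hr : (⇑((hMap (M.map σ) (N.map σ)).restrictScalars F) ∘
      fun q ↦ pairMap σ (homogBasis A L (oddLabel t M N) q)) =
      fun q ↦ pairMap σ (hMap M N (homogBasis A L (oddLabel t M N) q)) := by
    funext q
    simp only [Function.comp_apply, LinearMap.coe_restrictScalars, hMap_pairMap]
  rw [hr]

end GMFData

/-- **Registered sub-goal: the rank of the odd differential of a base change is the dimension of the
span of the images of one finite family of vectors over the coefficient ring.** [folklore] -/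
theorem hRank_baseChange_eq_finrank_span : ∀ (A F : Type) [CommRing A] [Field F] (σ : A →+* F)
    (ν m : ℕ) (L : AddSubgroup (Fin ν → ZMod m)) (ι₀ ι₁ κ₀ κ₁ : Type) [Fintype ι₀] [Fintype ι₁]
    [Fintype κ₀] [Fintype κ₁] (t : ℤ) (M : GMFData A ν m ι₀ ι₁) (N : GMFData A ν m κ₀ κ₁),
    GMFData.hRank L t (M.map σ) (N.map σ) = Module.finrank F (Submodule.span F
      (Set.range (fun q ↦ pairMap σ (GMFData.hMap M N (homogBasis A L (GMFData.oddLabel t M N) q))))) :=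
  fun _ _ _ _ σ _ _ L _ _ _ _ _ _ _ _ t M N ↦ GMFData.hRank_baseChange σ L t M N

end Summit.HodgeConjecture.HodgeConjecture.Cruxes.FermatAnchorAssembly.WittLiftRigidMf

end
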